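import Mathlib
import HarnessLib
import Summits.ValiantsHypothesis.ValiantsHypothesis.Theses.ChowBorderDepth3
import Summits.ValiantsHypothesis.ValiantsHypothesis.Theorems.ChowBorderDepth3Assembly
import Summits.ValiantsHypothesis.ValiantsHypothesis.Theorems.ChowBorderDepth3ChowToThesis
import Summits.ValiantsHypothesis.ValiantsHypothesis.Theorems.ChowBorderDepth3SPSNormalForm
import Summits.ValiantsHypothesis.ValiantsHypothesis.Theorems.ChowBorderDepth3Depth3Chasm
import Summits.ValiantsHypothesis.ValiantsHypothesis.Theorems.ChowBorderDepth3ChowBorderBoundFanInTwo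
import Summits.ValiantsHypothesis.ValiantsHypothesis.Theorems.ChowBorderDepth3ChowBorderBoundPaddedFlatteningRung
import Summits.ValiantsHypothesis.ValiantsHypothesis.Theorems.ChowBorderDepth3ChowBorderBoundNegativeDBound
import Summits.ValiantsHypothesis.ValiantsHypothesis.Theorems.ChowBorderDepth3ChowBorderBoundNegativeRBound
import Summits.ValiantsHypothesis.ValiantsHypothesis.Theorems.ChowBorderDepth3ChowBorderBoundOfGraded
import Literature.Computability.AlgebraicComplexity.DetInVP
import Literature.Computability.AlgebraicComplexity.OrbitClosure

/-!
# Strategy census — typed companion for crux `ChowBorderDepth3.ChowBorderBound`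
(stmt-ValiantsHypothesis-5936; strategist `cstrat-stmt-ValiantsHypothesis-5936-r1`, 2026-08-17)

This file accompanies `Cruxes/ChowBorderBound/STRATEGY-CENSUS.md`.  Everything here is
sorry-free; statements that are merely TYPED (not proved) are `def … : Prop`.

Contents.
* §0 vocabulary: `HasBorderSPS f r D` (a border `(r, D)` expression of `f` in the crux's exact
  ε-algebra shape), `chasm c n = (n+2)^(c⌊√n⌋+c)`; `chowBorderBound_iff` (the crux by name).
* §1 PROBES.  `valiantsHypothesis_of_chowBorderBound : ChowBorderBound → ValiantsHypothesis`
  — the crux implies the summit OUTRIGHT through tree theorems (`chowToThesis_proof`,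
  `SPSNormalForm_proof`, `depth3Chasm_proof`, `chowBorderDepth3_assembly_proof` and three
  discharged Literature facts).  So `C → S` is certified; the converse probe fails (scratch file
  `bc/probe_StoC.lean`, quoted in the census).
* §2 TRANSFER.  `unpaddedSibling_holds` — the unpadded (`D = n`) version of the crux is a tree
  theorem (flattenings); `not_chowBorderBoundDet` — the determinant twin of the crux is FALSE
  (GKKS chasm for `det ∈ VP`, all proved in the tree), so every argument insensitive to the
  difference between `per_n` and `det_n` is refuted.
* §3 STRENGTHEN.  `strengthen_dropDBound_false`, `strengthen_dropRBound_false` (tree: Kumar,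
  Ryser); the GCT strengthening `BorderDcChasm` (typed).
* §4 DECOMPOSITION.  `chowBorderBound_iff_core` — after the landed rungs (`r ≤ 2`, padding
  `D^5 ≤ n^7`) the open piece `Core` of the regime split is EQUIVALENT to the crux; the
  de-bordering split (`EpsDegreeReduction`, `EpsInterpolation`, `ExactChasmBound`) typed.
* §5 NEGATION.  `not_chowBorderBound_iff` and the two calibrating constructions by name.
-/

set_option linter.dupNamespace false
set_option linter.unusedVariables false

namespace Summit.ValiantsHypothesis.ValiantsHypothesis.Cruxes.ChowBorderBound.Strategist

open Summit.ValiantsHypothesis.ValiantsHypothesis.Theses.ChowBorderDepth3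
open Summit.ValiantsHypothesis.ValiantsHypothesis.Theorems
open Literature.Computability.AlgebraicComplexity
open scoped BigOperators Polynomial

/-! ### §0 Vocabulary -/

/-- A border `(r, D)` expression of `f`: `Σ_{i<r} Π_{j<D} ℓ_ij(ε) = ε^q f + ε^(q+1) G` with affine
`ℓ_ij` over `ℂ[ε]` — literally the `∃`-block negated inside `ChowBorderBound`. -/
def HasBorderSPS {σ : Type*} (f : MvPolynomial σ ℂ) (r D : ℕ) : Prop :=
  ∃ (q : ℕ) (ℓ : Fin r → Fin D → MvPolynomial σ (Polynomial ℂ)) (G : MvPolynomial σ (Polynomial ℂ)),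
    (∀ i j, (ℓ i j).totalDegree ≤ 1) ∧
    (∑ i, ∏ j, ℓ i j) = MvPolynomial.C (Polynomial.X ^ q) * MvPolynomial.map Polynomial.C f +
      MvPolynomial.C (Polynomial.X ^ (q + 1)) * G

/-- The chasm threshold `T_c(n) = (n+2)^(c⌊√n⌋+c)`. -/
abbrev chasm (c n : ℕ) : ℕ := (n + 2) ^ (c * Nat.sqrt n + c)

/-- The crux, by name, is the statement in this vocabulary (definitional). -/
theorem chowBorderBound_iff :
    ChowBorderBound ↔ ∀ c : ℕ, ∃ n₀ : ℕ, ∀ n ≥ n₀, ∀ r D : ℕ, r ≤ chasm c n → D ≤ chasm c n →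
      ¬ HasBorderSPS (perPoly (Fin n) ℂ) r D :=
  Iff.rfl

/-! ### §1 Probes: the crux implies the summit outright -/

/-- `C ⟹ Depth3Thesis` (the route's own proved glue). -/
theorem depth3Thesis_of_chowBorderBound (h : ChowBorderBound) : Depth3Thesis :=
  chowToThesis_proof h SPSNormalForm_proof

/-- **`C ⟹ S`.**  `ChowBorderBound` implies `ValiantsHypothesis` (`VP ℂ ≠ VNP ℂ`) through theorems
already in the tree: the proved glue `ChowToThesis` + `SPSNormalForm`, the proved depth-three chasm
`Depth3Chasm` (GKKS 2016 / Tavenas 2015, `depth3Chasm_proof`), the proved `Assembly`, and the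
discharged Literature facts `deg per_n = n`, `perFamily ∈ VP ↔ IsVPFamily per`, `per ∈ VNP`.
Hence the crux is AT LEAST summit-strength (tribunal T1: `C ≥ S` in print and in tree). -/
theorem valiantsHypothesis_of_chowBorderBound (h : ChowBorderBound) : _root_.ValiantsHypothesis :=
  chowBorderDepth3_assembly_proof ChowBorderDepth3Depth3Chasm.depth3Chasm_proof
    (depth3Thesis_of_chowBorderBound h)
    (fun n => by rw [totalDegree_perPoly_holds (n := Fin n) (k := ℂ), Fintype.card_fin])
    (mem_VP_ofFintype_iff_holds (fun n => perPoly (Fin n) ℂ))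
    (perFamily_mem_VNP_holds ℂ)

/-! ### §2 Transfer -/

/-- The UNPADDED sibling of the crux (`D = n`: border homogeneous-degree Chow expressions of
`per_n` with `r ≤ T_c(n)` summands do not exist, eventually in `n`).  A tree theorem: it is the
instance `D = n` of the landed small-padding rung (flattenings; `chowBorderBound_smallPadding`). -/
def UnpaddedSibling : Prop :=
  ∀ c : ℕ, ∃ n₀ : ℕ, ∀ n ≥ n₀, ∀ r : ℕ, r ≤ chasm c n → ¬ HasBorderSPS (perPoly (Fin n) ℂ) r n

theorem unpaddedSibling_holds : UnpaddedSibling := by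
  intro c
  obtain ⟨n₀, hn₀⟩ := ChowBorderBound.PaddedFlatteningRung.chowBorderBound_smallPadding c
  refine ⟨n₀, fun n hn r hr => hn₀ n hn r n hr ?_⟩
  rcases Nat.eq_zero_or_pos n with h0 | hpos
  · subst h0; simp
  · exact Nat.pow_le_pow_right hpos (by norm_num)

/-- The DETERMINANT twin of the crux: the same statement with `det_n` for `per_n`. -/
def ChowBorderBoundDet : Prop :=
  ∀ c : ℕ, ∃ n₀ : ℕ, ∀ n ≥ n₀, ∀ r D : ℕ, r ≤ chasm c n → D ≤ chasm c n →
    ¬ HasBorderSPS (detPoly (Fin n) ℂ) r D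

/-- **The determinant twin is FALSE** (GKKS 2016 Thm 1.1 / Landsberg 2017 Cor. 7.5.3.2, here from
tree theorems only): `det ∈ VP` (`isVPFamily_detPoly_holds`), the proved depth-three chasm gives
ΣΠΣ circuits with `≤ T_c(n)` wires for every `n`, and the ΣΠΣ normal form
(`exists_sps_of_productDepth_le_one`) turns such a circuit into an exact `(E+1, E+1)` expression,
`E + 1 ≤ T_{c+1}(n)`.  Consequence: any proof of the crux must use a property of `per_n` that
`det_n` lacks (same support, same flattening ranks, same Newton polytope, same torus weights). -/
theorem not_chowBorderBoundDet : ¬ ChowBorderBoundDet := by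
  intro h
  obtain ⟨c, hc⟩ := ChowBorderDepth3Depth3Chasm.depth3Chasm_proof
    (fun n => detPoly (Fin n) ℂ) (isVPFamily_detPoly_holds ℂ)
  obtain ⟨n₀, hn₀⟩ := h (c + 1)
  obtain ⟨P, hP, hdepth, hsize⟩ := hc n₀
  have hdeg : (detPoly (Fin n₀) ℂ).totalDegree = n₀ := by
    rw [totalDegree_detPoly_holds (n := Fin n₀) (k := ℂ), Fintype.card_fin]
  rw [hdeg] at hsize
  obtain ⟨ℓ, hℓdeg, hℓsum⟩ := exists_sps_of_productDepth_le_one P hdepth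
  have hsum : (∑ i, ∏ j, ℓ i j) = detPoly (Fin n₀) ℂ := hℓsum.trans hP
  have hbound := chowToThesis_succ_le_pow hsize
  refine hn₀ n₀ le_rfl (P.edgeSize + 1) (P.edgeSize + 1) hbound hbound
    ⟨0, fun i j => MvPolynomial.map Polynomial.C (ℓ i j), 0, ?_, ?_⟩
  · intro i j
    exact (Finset.sup_mono (MvPolynomial.support_map_subset _ _)).trans (hℓdeg i j)
  · have hmap : (∑ i, ∏ j, MvPolynomial.map Polynomial.C (ℓ i j)) =
        MvPolynomial.map (σ := Fin n₀ × Fin n₀) Polynomial.C (∑ i, ∏ j, ℓ i j) := by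
      simp only [map_sum, map_prod]
    rw [hmap, hsum]
    simp

/-- PADDING REMOVAL with quasi-polynomial loss (typed; the structural half of the split
"de-pad, then use the unpadded theorem"): a border `(r, D)` expression of the padded `f` in the
chasm range yields an unpadded one (`D = deg f = n`) in a (larger) chasm range.  Stated for an
arbitrary family `f` of `n × n`-matrix polynomials; for `f = det` it is FALSE
(`not_paddingRemoval_det`), so as a lemma it can only hold for `per` by being the crux again. -/
def PaddingRemoval (f : ∀ n : ℕ, MvPolynomial (Fin n × Fin n) ℂ) : Prop :=
  ∀ c : ℕ, ∃ c' n₀ : ℕ, ∀ n ≥ n₀, ∀ r D : ℕ, r ≤ chasm c n → D ≤ chasm c n →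
    HasBorderSPS (f n) r D → ∃ r' : ℕ, r' ≤ chasm c' n ∧ HasBorderSPS (f n) r' n

/-- The unpadded determinant bound (flattenings, Nisan–Wigderson 1996: homogeneous-degree border
Chow expressions of `det_n` need `≥ C(n,⌊n/2⌋)` summands) — typed as a named statement; it is the
`det` copy of `unpaddedSibling_holds` and holds by the same flattening argument (not re-proved
here). -/
def UnpaddedDet : Prop :=
  ∀ c : ℕ, ∃ n₀ : ℕ, ∀ n ≥ n₀, ∀ r : ℕ, r ≤ chasm c n → ¬ HasBorderSPS (detPoly (Fin n) ℂ) r n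

/-- Padding removal for `det` contradicts the (flattening) unpadded determinant bound: given both,
the determinant twin of the crux would follow, which is false. -/
theorem not_paddingRemoval_det (hU : UnpaddedDet) :
    ¬ PaddingRemoval (fun n => detPoly (Fin n) ℂ) := by
  intro hPR
  apply not_chowBorderBoundDet
  intro c
  obtain ⟨c', n₁, h₁⟩ := hPR c
  obtain ⟨n₂, h₂⟩ := hU c'
  refine ⟨max n₁ n₂, fun n hn r D hr hD hB => ?_⟩
  obtain ⟨r', hr', hB'⟩ := h₁ n (le_trans (le_max_left _ _) hn) r D hr hD hB
  exact h₂ n (le_trans (le_max_right _ _) hn) r' hr' hB'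

/-! ### §3 Strengthen -/

/-- Dropping the bound on `D` makes the crux FALSE (Kumar 2020: `r = 2`, `D = n·n!·2^n`; tree). -/
theorem strengthen_dropDBound_false :
    ¬ ∀ c : ℕ, ∃ n₀ : ℕ, ∀ n ≥ n₀, ∀ r D : ℕ, r ≤ chasm c n →
      ¬ HasBorderSPS (perPoly (Fin n) ℂ) r D :=
  ChowBorderBound.NegativeDBound.chowBorderBound_false_without_DBound

/-- Dropping the bound on `r` makes the crux FALSE (Ryser: `r = 2^n`, `D = n`; tree). -/
theorem strengthen_dropRBound_false :
    ¬ ∀ c : ℕ, ∃ n₀ : ℕ, ∀ n ≥ n₀, ∀ r D : ℕ, D ≤ chasm c n →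
      ¬ HasBorderSPS (perPoly (Fin n) ℂ) r D :=
  ChowBorderBound.NegativeRBound.chowBorderBound_false_without_rBound

/-- The GCT strengthening (typed): border determinantal complexity of `per_n` beyond the chasm,
`T_c(n) < \underline{dc}(per_n)` eventually, for every `c` — the quasi-polynomial form of the
Mulmuley–Sohoni conjecture.  It implies the crux (a border ΣΠΣ expression of size `s` is a border
determinantal expression of size `O(s)`, Valiant 1979), is the target of the summit's GCT routes,
and is harder: occurrence obstructions are excluded (BIP 2019, barrier `GCTOccurrenceObstructions`)
and GCT-useful modules need first rows `≥ d(m-n)` (Kadish–Landsberg, barrier `GCTUsefulModules`). -/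
def BorderDcChasm : Prop :=
  ∀ c : ℕ, ∃ n₀ : ℕ, ∀ n ≥ n₀, chasm c n < borderDetComplexityPer ℂ n

/-! ### §4 Decomposition -/

/-- The OPEN CORE of the regime split: top fan-in `r ≥ 3` and padding `D^5 > n^7`
(`D ≳ n^{1.4}`), inside the chasm range. -/
def Core : Prop :=
  ∀ c : ℕ, ∃ n₀ : ℕ, ∀ n ≥ n₀, ∀ r D : ℕ, 3 ≤ r → n ^ 7 < D ^ 5 → r ≤ chasm c n → D ≤ chasm c n →
    ¬ HasBorderSPS (perPoly (Fin n) ℂ) r D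

/-- **The regime split has no teeth**: with the landed rungs `r ≤ 2` (`chowBorderBound_fanInLeTwo`,
Kumar-tightness for `per_n`) and `D^5 ≤ n^7` (`chowBorderBound_paddingBelowThreeHalves 7 5`,
padded flattenings), the open piece `Core` is EQUIVALENT to the crux.  A `route edit --split` along
regimes would therefore file the crux again under a new name (BC2 (c) fails: the piece gives `C`,
hence `S`, on its own). -/
theorem chowBorderBound_iff_core : ChowBorderBound ↔ Core := by
  constructor
  · intro h c
    obtain ⟨n₀, hn₀⟩ := h c
    exact ⟨n₀, fun n hn r D _ _ hr hD => hn₀ n hn r D hr hD⟩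
  · intro hCore c
    obtain ⟨n₁, h₁⟩ := hCore c
    obtain ⟨n₂, h₂⟩ := ChowBorderBound.FanInTwo.chowBorderBound_fanInLeTwo c
    obtain ⟨n₃, h₃⟩ :=
      ChowBorderBound.PaddedFlatteningRung.chowBorderBound_paddingBelowThreeHalves 7 5 c (by norm_num)
    refine ⟨max n₁ (max n₂ n₃), fun n hn r D hr hD => ?_⟩
    have hn₁ : n₁ ≤ n := le_trans (le_max_left _ _) hn
    have hn₂ : n₂ ≤ n := le_trans ((le_max_left _ _).trans (le_max_right _ _)) hn
    have hn₃ : n₃ ≤ n := le_trans ((le_max_right _ _).trans (le_max_right _ _)) hn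
    by_cases hr2 : r ≤ 2
    · exact h₂ n hn₂ r D hr2 hD
    · by_cases hD5 : D ^ 5 ≤ n ^ 7
      · exact h₃ n hn₃ r D hr hD5
      · exact h₁ n hn₁ r D (by omega) (by omega) hr hD

/-- A border expression whose coefficients have `ε`-degree `≤ e` (typed). -/
def HasBorderSPSDeg {σ : Type*} (f : MvPolynomial σ ℂ) (r D e : ℕ) : Prop :=
  ∃ (q : ℕ) (ℓ : Fin r → Fin D → MvPolynomial σ (Polynomial ℂ)) (G : MvPolynomial σ (Polynomial ℂ)),
    (∀ i j, (ℓ i j).totalDegree ≤ 1) ∧ (∀ i j m, ((ℓ i j).coeff m).natDegree ≤ e) ∧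
    (∑ i, ∏ j, ℓ i j) = MvPolynomial.C (Polynomial.X ^ q) * MvPolynomial.map Polynomial.C f +
      MvPolynomial.C (Polynomial.X ^ (q + 1)) * G

/-- An EXACT `(r, D)` expression (`q = 0`, no `ε`). -/
def HasSPS {σ : Type*} (f : MvPolynomial σ ℂ) (r D : ℕ) : Prop :=
  ∃ ℓ : Fin r → Fin D → MvPolynomial σ ℂ, (∀ i j, (ℓ i j).totalDegree ≤ 1) ∧ (∑ i, ∏ j, ℓ i j) = f

/-- De-bordering split, piece 1 (typed, open, structural): in the chasm range the `ε`-degree of a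
border expression of `per_n` can be taken quasi-polynomial. -/
def EpsDegreeReduction : Prop :=
  ∀ c : ℕ, ∃ c' n₀ : ℕ, ∀ n ≥ n₀, ∀ r D : ℕ, r ≤ chasm c n → D ≤ chasm c n →
    HasBorderSPS (perPoly (Fin n) ℂ) r D →
      ∃ r' D' e : ℕ, r' ≤ chasm c' n ∧ D' ≤ chasm c' n ∧ e ≤ chasm c' n ∧
        HasBorderSPSDeg (perPoly (Fin n) ℂ) r' D' e

/-- De-bordering split, piece 2 (typed, TRUE, elementary — Lagrange interpolation in `ε` over
`D·e + 1` nodes extracts the coefficient of `ε^q`): bounded `ε`-degree de-borders with polynomial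
loss `r ↦ r(De+1)`. -/
def EpsInterpolation : Prop :=
  ∀ {σ : Type} [Fintype σ] (f : MvPolynomial σ ℂ) (r D e : ℕ),
    HasBorderSPSDeg f r D e → HasSPS f (r * (D * e + 1)) D

/-- De-bordering split, piece 3: the EXACT chasm bound — the route's target `Depth3Thesis` in
expression form (summit-strength: with the proved `Depth3Chasm` it gives `VP ≠ VNP`). -/
def ExactChasmBound : Prop :=
  ∀ c : ℕ, ∃ n₀ : ℕ, ∀ n ≥ n₀, ∀ r D : ℕ, r ≤ chasm c n → D ≤ chasm c n →
    ¬ HasSPS (perPoly (Fin n) ℂ) r D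

/-- `chasm` is monotone in `c`. -/
theorem chasm_mono {c c' : ℕ} (h : c ≤ c') (n : ℕ) : chasm c n ≤ chasm c' n :=
  Nat.pow_le_pow_right (by omega) (by nlinarith)

/-- `T_a · T_b ≤ T_{a+b}` and hence products of chasm quantities stay in a chasm range. -/
theorem chasm_mul_le (a b n : ℕ) : chasm a n * chasm b n ≤ chasm (a + b) n := by
  unfold chasm
  rw [← pow_add]
  exact Nat.pow_le_pow_right (by omega) (by nlinarith)

/-- The de-bordering split COMPOSES (proved): `EpsDegreeReduction`, `EpsInterpolation` and the exact
chasm bound give the crux.  Its third piece is summit-strength (it is `Depth3Thesis` in expression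
form), so the split fails BC2 (c) — recorded, not filed. -/
theorem chowBorderBound_of_debordering (h₁ : EpsDegreeReduction) (h₂ : EpsInterpolation)
    (h₃ : ExactChasmBound) : ChowBorderBound := by
  rw [chowBorderBound_iff]
  intro c
  obtain ⟨c', n₁, hred⟩ := h₁ c
  -- the exact bound at exponent 3c'+1 absorbs r'(D'e+1) ≤ T_{c'}(T_{c'}T_{c'}+1) ≤ T_{3c'+1}
  obtain ⟨n₂, hex⟩ := h₃ (3 * c' + 1)
  refine ⟨max n₁ n₂, fun n hn r D hr hD hB => ?_⟩
  obtain ⟨r', D', e, hr', hD', he, hB'⟩ := hred n (le_trans (le_max_left _ _) hn) r D hr hD hB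
  have hS := h₂ (perPoly (Fin n) ℂ) r' D' e hB'
  refine hex n (le_trans (le_max_right _ _) hn) (r' * (D' * e + 1)) D' ?_ ?_ hS
  · have h1 : D' * e + 1 ≤ chasm (2 * c' + 1) n := by
      have hm : D' * e ≤ chasm (c' + c') n :=
        (Nat.mul_le_mul hD' he).trans (chasm_mul_le c' c' n)
      have h2 : chasm (c' + c') n * 2 ≤ chasm (2 * c' + 1) n := by
        unfold chasm
        calc (n + 2) ^ ((c' + c') * Nat.sqrt n + (c' + c')) * 2
            ≤ (n + 2) ^ ((c' + c') * Nat.sqrt n + (c' + c')) * (n + 2) ^ 1 := by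
              apply Nat.mul_le_mul_left; simp
          _ = (n + 2) ^ ((c' + c') * Nat.sqrt n + (c' + c') + 1) := by rw [← pow_add]
          _ ≤ (n + 2) ^ ((2 * c' + 1) * Nat.sqrt n + (2 * c' + 1)) :=
              Nat.pow_le_pow_right (by omega) (by nlinarith)
      have h3 : 1 ≤ chasm (c' + c') n := Nat.one_le_pow _ _ (by omega)
      omega
    calc r' * (D' * e + 1) ≤ chasm c' n * chasm (2 * c' + 1) n := Nat.mul_le_mul hr' h1
      _ ≤ chasm (c' + (2 * c' + 1)) n := chasm_mul_le _ _ _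
      _ = chasm (3 * c' + 1) n := by ring_nf
  · exact hD'.trans (chasm_mono (by omega) n)

/-! ### §5 Negation -/

/-- A counterexample to the crux is exactly: one exponent `c` and border chasm-range expressions of
`per_n` for infinitely many `n` — a `2^(O(√n log n))` border ΣΠΣ upper bound for the permanent. -/
theorem not_chowBorderBound_iff :
    ¬ ChowBorderBound ↔ ∃ c : ℕ, ∀ n₀ : ℕ, ∃ n ≥ n₀, ∃ r D : ℕ, r ≤ chasm c n ∧ D ≤ chasm c n ∧
      HasBorderSPS (perPoly (Fin n) ℂ) r D := by
  rw [chowBorderBound_iff]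
  push Not
  rfl

/-- Calibration (tree): Ryser's formula is a border (indeed exact-order) expression with
`r = 2^n`, `D = n` — just above the chasm in `r`. -/
theorem hasBorderSPS_ryser (n : ℕ) (hn : 1 ≤ n) : HasBorderSPS (perPoly (Fin n) ℂ) (2 ^ n) n :=
  ChowBorderBound.NegativeRBound.exists_border_ryser n hn

/-- Calibration (tree): Kumar's two-summand border expression, `r = 2`, `D` exponential. -/
theorem hasBorderSPS_kumar (n : ℕ) (hn : 1 ≤ n) : ∃ D : ℕ, HasBorderSPS (perPoly (Fin n) ℂ) 2 D := by
  obtain ⟨D, q, ℓ, G, h⟩ := ChowBorderBound.NegativeDBound.exists_border_fanInTwo n hn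
  exact ⟨D, q, ℓ, G, h⟩

end Summit.ValiantsHypothesis.ValiantsHypothesis.Cruxes.ChowBorderBound.Strategist

#print axioms Summit.ValiantsHypothesis.ValiantsHypothesis.Cruxes.ChowBorderBound.Strategist.valiantsHypothesis_of_chowBorderBound
#print axioms Summit.ValiantsHypothesis.ValiantsHypothesis.Cruxes.ChowBorderBound.Strategist.not_chowBorderBoundDet
#print axioms Summit.ValiantsHypothesis.ValiantsHypothesis.Cruxes.ChowBorderBound.Strategist.chowBorderBound_iff_core
#print axioms Summit.ValiantsHypothesis.ValiantsHypothesis.Cruxes.ChowBorderBound.Strategist.chowBorderBound_of_debordering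
#print axioms Summit.ValiantsHypothesis.ValiantsHypothesis.Cruxes.ChowBorderBound.Strategist.unpaddedSibling_holds
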